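import Literature.NumberTheory.Automorphic.ArchCentralDescentRankTwoEngine   -- ★ FILE A1 (this seat): `Λ_x` locality∕homogeneity, the single-place engine `tendsto_lambda8_sum_perm_integral_integral_insert`
import Literature.NumberTheory.Automorphic.ArchCentralDescentRankTwoFamily   -- ★ p842318 (F0P3a-p06): the measure family `M(S,u,σ)` (Radon, σ-finite, updates at one place)
import HarnessLib

/-!
# ONE DESCENT STEP of the (S-d) central identity at a place `w₁ ∈ S` — the `hstep` INSTANCE of ★ `descent_two_sided_prod_mul_eq` for the mixed integrals `I(S,u) = Σ_σ ∫ Θ ↑↑e⁻¹ d(⊗_w M(S,u,σ)_w)`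
# (Rogawski 1990 §8.4 pp. 126–127, §14.5 p. 239 «from the limit formulas if `v ∈ S₀`»)

Topic `NumberTheory/Automorphic`; namespace `Literature.NumberTheory.Automorphic.UnitaryGroup`.  THEOREMS ONLY (no `def`, no instance, no notation, no axiom, no named fact, no `sorry`).
Cell `pub/hodgecm-mathlib`, ENGINE T1 (crux H413 = `stmt-HodgeConjecture-24833`); ROAD-Sd residual R4 (`stub_SdCanonical`), SdArch ED. 3 node **N5 «E2-central»** (LEAD WORD T8-135; census 783c9612 §2a∕§2b),
FILE A2; author F0P3a-p03 (g11), 2026-09-01.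

THE DATA (no definitions; tokens = ★ `ArchCentralDescentRankTwoFamily`).  `G_w = archLocal L 3 (diag α) w`, local Haar `νw w`, centre `z : W → S¹`, torus data `u : W → Fin 3 → S¹`, labels
`σ : W → S₃`; `M(S,u,σ)_w = conj(diag(u_w ∘ σ_w))_*(νw w)` for `w ∈ S`, `δ_{diag(z_w,z_w,z_w)}` off `S`; `I(S,u) = Σ_σ ∫ Θ ↑↑e⁻¹(o) d(⊗_w M(S,u,σ)_w)(o)`.

WHAT IS PROVED.  **`tendsto_lambda8_sum_integral_pi_update`**: for `w₁ ∈ S`, `u` regular (injective) on `S ∖ w₁`, the (L) letter OPENED at `w₁` for `νw w₁` with constant `c`: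
  `Λ_x[ r ↦ I(S, u[w₁ ↦ r]) ] → −(c·i) · I(S ∖ w₁, u)`   as `x → (z_{w₁}, z_{w₁}, z_{w₁})` within `{x | x injective}`
— i.e. exactly the hypothesis `hstep` of ★ `descent_two_sided_prod_mul_eq` (F0P3a-p06) at `X := Fin 3 → Circle`, `R := {injective}`, `Λ w f x := Λ_x[f]`, `G S u := I(S,u)`, `c w := −(c_w·i)`
(the label multiplicity — 2 per class on `U(2,1)`, 6 on `U(3)` — CANCELS between `Λ[I(S,·)]` and `I(S ∖ w₁,·)`).  Proof: at a regular `r` the family `M(S, u[w₁ ↦ r], σ)` is `M(S ∖ w₁, u, σ)`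
updated at `w₁` by the orbit measure of `diag(r ∘ σ_{w₁})`; Fubini at `w₁` (★ `integral_pi_update_map_conj_circleDiagonal_archLocal`) and the splitting `σ ↦ (σ_{w₁}, σ|_{≠w₁})` (`Equiv.piSplitAt`)
turn `I(S, u[w₁ ↦ r])` into the engine's label sum — on the REGULAR set only, which is all `Λ_x` sees (★ `lambda8_rhoWeylDelta_mul_congr`); the engine gives the limit; its frozen value is
`I(S ∖ w₁, u)` (★ `measureFamily₃_eq_update_dirac`, ★ `integral_pi_update_dirac_archLocal`, the six labels at `w₁` idle).
HONEST LABEL: HC_CM is proved only modulo the printed citations until rung 0 closes; measure bookkeeping over FILE A1, pays nothing by itself.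

## References
* [Rogawski1990] J. D. Rogawski, *Automorphic Representations of Unitary Groups in Three Variables*, Ann. of Math. Stud. 123 (1990), §8.4 pp. 126–127, §14.5 p. 239.
* [BorelJacquet1979] A. Borel, H. Jacquet, *Automorphic forms and automorphic representations*, PSPM 33.1 (1979), §4.1.
-/

set_option autoImplicit false

noncomputable section

open MeasureTheory Matrix NumberField NumberField.InfinitePlace NumberField.mixedEmbedding Set Function Filter Topology
open scoped MatrixGroups ContDiff

namespace Literature.NumberTheory.Automorphic.UnitaryGroup

open Literature.NumberTheory.Rogawski1990 Literature.Analysis.Calculus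

-- the scoped `L^∞`-operator norm on `M_N(ℂ)` and `M_N(L ⊗ ℝ)`, the cell's ambient-smooth convention
open scoped Matrix.Norms.Operator

/-! ## The `hstep` instance: one descent step of the (S-d) identity at a place `w₁ ∈ S` -/

section Step

variable (L : Type) [Field L] [NumberField L] [IsCMField L] (α : Fin 3 → L)
  [∀ w : {w : InfinitePlace L // IsComplex w}, MeasurableSpace (archLocal L 3 (Matrix.diagonal α) w)]
  [∀ w : {w : InfinitePlace L // IsComplex w}, BorelSpace (archLocal L 3 (Matrix.diagonal α) w)]
  (νw : ∀ w : {w : InfinitePlace L // IsComplex w}, Measure (archLocal L 3 (Matrix.diagonal α) w)) [∀ w, (νw w).IsHaarMeasure]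
  (z : {w : InfinitePlace L // IsComplex w} → Circle)

open scoped Classical in
/-- **ONE DESCENT STEP FOR (S-d) — the `hstep` of ★ `descent_two_sided_prod_mul_eq`, instantiated.**  With the measure family `M(S,u,σ)` of ★ `ArchCentralDescentRankTwoFamily` and the mixed
integral `I(S,u) = Σ_σ ∫ Θ ↑↑e⁻¹ d(⊗_w M(S,u,σ)_w)`: for `w₁ ∈ S`, `u` regular on `S ∖ w₁` and the (L) letter at `w₁` (opened, constant `c`), the letter's functional of
`x ↦ I(S, u[w₁ ↦ x])` tends to `−(c·i)·I(S ∖ w₁, u)` as `x → (z_{w₁},z_{w₁},z_{w₁})` through regular points.  Proof: at regular `x` the family `M(S, u[w₁ ↦ x], σ)` is `M(S ∖ w₁, u, σ)` updated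
at `w₁` by the orbit measure of `diag(x ∘ σ_{w₁})` (★ `measureFamily₃_update_eq_update`), Fubini at `w₁` (★ `integral_pi_update_map_conj_circleDiagonal_archLocal`) and the splitting
`σ ↦ (σ_{w₁}, σ|_{≠ w₁})` (`Equiv.piSplitAt`) turn `I(S, u[w₁ ↦ x])` into §2's label sum — ON THE REGULAR SET, which is all `Λ₈[ρ′Δ · −]` sees (§1 congruence); §2 gives the limit, and
its frozen value is `I(S ∖ w₁, u)` (★ `measureFamily₃_eq_update_dirac`, ★ `integral_pi_update_dirac_archLocal`). [cite: Rogawski1990, §8.4 pp. 126–127; §14.5 p. 239] -/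
theorem tendsto_lambda8_sum_integral_pi_update
    (hα : ∀ i, α i ≠ 0) (Θ : Matrix (Fin 3) (Fin 3) (mixedSpace L) → ℂ) (hΘ : ContDiff ℝ (⊤ : ℕ∞) Θ)
    (hΘc : HasCompactSupport fun g : arch (↥(maximalRealSubfield L)) L (IsCMField.complexConj L) 3 (Matrix.diagonal α) =>
      Θ ((g : GL (Fin 3) (mixedSpace L)) : Matrix (Fin 3) (Fin 3) (mixedSpace L)))
    (S : Finset {w : InfinitePlace L // IsComplex w}) (w₁ : {w : InfinitePlace L // IsComplex w}) (hw₁ : w₁ ∈ S) (hreal : ∀ i, (w₁.1.embedding (α i)).im = 0)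
    (u : {w : InfinitePlace L // IsComplex w} → Fin 3 → Circle) (hu : ∀ w ∈ S.erase w₁, Function.Injective (u w))
    (c : ℝ)
    (hL : ∀ (Θ' : Matrix (Fin 3) (Fin 3) ℂ → ℂ), ContDiff ℝ (⊤ : ℕ∞) Θ' →
        HasCompactSupport (fun k : archLocal L 3 (Matrix.diagonal α) w₁ => Θ' ((k : GL (Fin 3) ℂ) : Matrix (Fin 3) (Fin 3) ℂ)) →
        ∀ ζ' : Circle,
          Tendsto (fun x : Fin 3 → Circle =>
              (1 / 48 : ℂ) * ∑ ε : Fin 3 → Bool, ((((if ε 0 then (1 : ℝ) else -1) * (if ε 1 then (1 : ℝ) else -1) * (if ε 2 then (1 : ℝ) else -1) : ℝ)) : ℂ) *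
          iteratedDeriv 3 (fun s : ℝ => ((((((x 0 * Circle.exp (s * (![(if ε 0 then (1 : ℝ) else -1) + (if ε 1 then (1 : ℝ) else -1), -(if ε 0 then (1 : ℝ) else -1) + (if ε 2 then (1 : ℝ) else -1), -(if ε 1 then (1 : ℝ) else -1) - (if ε 2 then (1 : ℝ) else -1)] 0))) : Circle) : ℂ)) * ((((x 2 * Circle.exp (s * (![(if ε 0 then (1 : ℝ) else -1) + (if ε 1 then (1 : ℝ) else -1), -(if ε 0 then (1 : ℝ) else -1) + (if ε 2 then (1 : ℝ) else -1), -(if ε 1 then (1 : ℝ) else -1) - (if ε 2 then (1 : ℝ) else -1)] 2))) : Circle) : ℂ))⁻¹) * ((1 - ((((x 1 * Circle.exp (s * (![(if ε 0 then (1 : ℝ) else -1) + (if ε 1 then (1 : ℝ) else -1), -(if ε 0 then (1 : ℝ) else -1) + (if ε 2 then (1 : ℝ) else -1), -(if ε 1 then (1 : ℝ) else -1) - (if ε 2 then (1 : ℝ) else -1)] 1))) : Circle) : ℂ)) * ((((x 0 * Circle.exp (s * (![(if ε 0 then (1 : ℝ) else -1) + (if ε 1 then (1 : ℝ) else -1),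 -(if ε 0 then (1 : ℝ) else -1) + (if ε 2 then (1 : ℝ) else -1), -(if ε 1 then (1 : ℝ) else -1) - (if ε 2 then (1 : ℝ) else -1)] 0))) : Circle) : ℂ))⁻¹) * (1 - ((((x 2 * Circle.exp (s * (![(if ε 0 then (1 : ℝ) else -1) + (if ε 1 then (1 : ℝ) else -1), -(if ε 0 then (1 : ℝ) else -1) + (if ε 2 then (1 : ℝ) else -1), -(if ε 1 then (1 : ℝ) else -1) - (if ε 2 then (1 : ℝ) else -1)] 2))) : Circle) : ℂ)) * ((((x 1 * Circle.exp (s * (![(if ε 0 then (1 : ℝ) else -1) + (if ε 1 then (1 : ℝ) else -1), -(if ε 0 then (1 : ℝ) else -1) + (if ε 2 then (1 : ℝ) else -1), -(if ε 1 then (1 : ℝ) else -1) - (if ε 2 then (1 : ℝ) else -1)] 1))) : Circle) : ℂ))⁻¹) * (1 - ((((x 2 * Circle.exp (s * (![(if ε 0 then (1 : ℝ) else -1) + (if ε 1 then (1 : ℝ) else -1), -(if ε 0 then (1 : ℝ) else -1) + (if ε 2 then (1 : ℝ) else -1), -(if ε 1 then (1 : ℝ) else -1) - (if ε 2 then (1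 : ℝ) else -1)] 2))) : Circle) : ℂ)) * ((((x 0 * Circle.exp (s * (![(if ε 0 then (1 : ℝ) else -1) + (if ε 1 then (1 : ℝ) else -1), -(if ε 0 then (1 : ℝ) else -1) + (if ε 2 then (1 : ℝ) else -1), -(if ε 1 then (1 : ℝ) else -1) - (if ε 2 then (1 : ℝ) else -1)] 0))) : Circle) : ℂ))⁻¹))) * ((∫ g, Θ' (((g * ⟨circleDiagonal 3 (fun k => x k * Circle.exp (s * (![(if ε 0 then (1 : ℝ) else -1) + (if ε 1 then (1 : ℝ) else -1), -(if ε 0 then (1 : ℝ) else -1) + (if ε 2 then (1 : ℝ) else -1), -(if ε 1 then (1 : ℝ) else -1) - (if ε 2 then (1 : ℝ) else -1)] k))), circleDiagonal_mem_archLocal_diagonal L 3 α w₁ _⟩ * g⁻¹ : archLocal L 3 (Matrix.diagonal α) w₁) : GL (Fin 3) ℂ) : Matrix (Fin 3) (Fin 3) ℂ) ∂(νw w₁)))) 0)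
            (𝓝[{x : Fin 3 → Circle | Function.Injective x}] (fun _ => ζ'))
            (𝓝 (-((c : ℂ) * Complex.I) * Θ' ((circleDiagonal 3 (fun _ => ζ') : GL (Fin 3) ℂ) : Matrix (Fin 3) (Fin 3) ℂ)))) :
    Tendsto (fun x : Fin 3 → Circle =>
        (1 / 48 : ℂ) * ∑ ε : Fin 3 → Bool, ((((if ε 0 then (1 : ℝ) else -1) * (if ε 1 then (1 : ℝ) else -1) * (if ε 2 then (1 : ℝ) else -1) : ℝ)) : ℂ) *
          iteratedDeriv 3 (fun s : ℝ => ((((((x 0 * Circle.exp (s * (![(if ε 0 then (1 : ℝ) else -1) + (if ε 1 then (1 : ℝ) else -1), -(if ε 0 then (1 : ℝ) else -1) + (if ε 2 then (1 : ℝ) else -1), -(if ε 1 then (1 : ℝ) else -1) - (if ε 2 then (1 : ℝ) else -1)] 0))) : Circle) : ℂ)) * ((((x 2 * Circle.exp (s * (![(if ε 0 then (1 : ℝ) else -1) + (if ε 1 then (1 : ℝ) else -1), -(if ε 0 then (1 : ℝ) else -1) + (if ε 2 then (1 : ℝ) else -1), -(if ε 1 then (1 : ℝ) else -1) - (if ε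 2 then (1 : ℝ) else -1)] 2))) : Circle) : ℂ))⁻¹) * ((1 - ((((x 1 * Circle.exp (s * (![(if ε 0 then (1 : ℝ) else -1) + (if ε 1 then (1 : ℝ) else -1), -(if ε 0 then (1 : ℝ) else -1) + (if ε 2 then (1 : ℝ) else -1), -(if ε 1 then (1 : ℝ) else -1) - (if ε 2 then (1 : ℝ) else -1)] 1))) : Circle) : ℂ)) * ((((x 0 * Circle.exp (s * (![(if ε 0 then (1 : ℝ) else -1) + (if ε 1 then (1 : ℝ) else -1), -(if ε 0 then (1 : ℝ) else -1) + (if ε 2 then (1 : ℝ) else -1), -(if ε 1 then (1 : ℝ) else -1) - (if ε 2 then (1 : ℝ) else -1)] 0))) : Circle) : ℂ))⁻¹) * (1 - ((((x 2 * Circle.exp (s * (![(if ε 0 then (1 : ℝ) else -1) + (if ε 1 then (1 : ℝ) else -1), -(if ε 0 then (1 : ℝ) else -1) + (if ε 2 then (1 : ℝ) else -1), -(if ε 1 then (1 : ℝ) else -1) - (if ε 2 then (1 : ℝ) else -1)] 2))) : Circle) : ℂ)) * ((((x 1 * Circle.exp (s * (![(if ε 0 then (1 : ℝ) else -1) + (if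 ε 1 then (1 : ℝ) else -1), -(if ε 0 then (1 : ℝ) else -1) + (if ε 2 then (1 : ℝ) else -1), -(if ε 1 then (1 : ℝ) else -1) - (if ε 2 then (1 : ℝ) else -1)] 1))) : Circle) : ℂ))⁻¹) * (1 - ((((x 2 * Circle.exp (s * (![(if ε 0 then (1 : ℝ) else -1) + (if ε 1 then (1 : ℝ) else -1), -(if ε 0 then (1 : ℝ) else -1) + (if ε 2 then (1 : ℝ) else -1), -(if ε 1 then (1 : ℝ) else -1) - (if ε 2 then (1 : ℝ) else -1)] 2))) : Circle) : ℂ)) * ((((x 0 * Circle.exp (s * (![(if ε 0 then (1 : ℝ) else -1) + (if ε 1 then (1 : ℝ) else -1), -(if ε 0 then (1 : ℝ) else -1) + (if ε 2 then (1 : ℝ) else -1), -(if ε 1 then (1 : ℝ) else -1) - (if ε 2 then (1 : ℝ) else -1)] 0))) : Circle) : ℂ))⁻¹))) * (∑ σ : {w : InfinitePlace L // IsComplex w} → Equiv.Perm (Fin 3),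
        ∫ o, Θ (((((archPiEquivCM 3 L (Matrix.diagonal α)).symm o) : arch (↥(maximalRealSubfield L)) L (IsCMField.complexConj L) 3 (Matrix.diagonal α)) : GL (Fin 3) (mixedSpace L)) : Matrix (Fin 3) (Fin 3) (mixedSpace L))
          ∂(Measure.pi (fun w : {w : InfinitePlace L // IsComplex w} =>
          if w ∈ S then (νw w).map (fun g : archLocal L 3 (Matrix.diagonal α) w =>
            g * ⟨circleDiagonal 3 ((Function.update u w₁ (fun k => x k * Circle.exp (s * (![(if ε 0 then (1 : ℝ) else -1) + (if ε 1 then (1 : ℝ) else -1), -(if ε 0 then (1 : ℝ) else -1) + (if ε 2 then (1 : ℝ) else -1), -(if ε 1 then (1 : ℝ) else -1) - (if ε 2 then (1 : ℝ) else -1)] k)))) w ∘ ⇑(σ w)), circleDiagonal_mem_archLocal_diagonal L 3 α w _⟩ * g⁻¹)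
          else Measure.dirac (⟨circleDiagonal 3 (fun _ => z w), circleDiagonal_mem_archLocal_diagonal L 3 α w _⟩ : archLocal L 3 (Matrix.diagonal α) w))))) 0)
      (𝓝[{x : Fin 3 → Circle | Function.Injective x}] (fun _ => z w₁))
      (𝓝 (-((c : ℂ) * Complex.I) * ∑ σ : {w : InfinitePlace L // IsComplex w} → Equiv.Perm (Fin 3),
        ∫ o, Θ (((((archPiEquivCM 3 L (Matrix.diagonal α)).symm o) : arch (↥(maximalRealSubfield L)) L (IsCMField.complexConj L) 3 (Matrix.diagonal α)) : GL (Fin 3) (mixedSpace L)) : Matrix (Fin 3) (Fin 3) (mixedSpace L))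
          ∂(Measure.pi (fun w : {w : InfinitePlace L // IsComplex w} =>
          if w ∈ S.erase w₁ then (νw w).map (fun g : archLocal L 3 (Matrix.diagonal α) w =>
            g * ⟨circleDiagonal 3 (u w ∘ ⇑(σ w)), circleDiagonal_mem_archLocal_diagonal L 3 α w _⟩ * g⁻¹)
          else Measure.dirac (⟨circleDiagonal 3 (fun _ => z w), circleDiagonal_mem_archLocal_diagonal L 3 α w _⟩ : archLocal L 3 (Matrix.diagonal α) w))))) := by
  haveI : ∀ w : {w : InfinitePlace L // IsComplex w}, SecondCountableTopology (archLocal L 3 (Matrix.diagonal α) w) :=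
    fun w => secondCountableTopology_archLocal L 3 (Matrix.diagonal α) w
  haveI : ∀ w : {w : InfinitePlace L // IsComplex w}, LocallyCompactSpace (archLocal L 3 (Matrix.diagonal α) w) :=
    fun w => locallyCompactSpace_archLocal L 3 (Matrix.diagonal α) w
  -- the test function on `∏_w G_w`
  obtain ⟨hFc, hFs⟩ := continuous_hasCompactSupport_comp_archPiEquivCM_symm₃ L α Θ hΘ.continuous hΘc
  have hFm := hFc.stronglyMeasurable
  -- the families `M(S ∖ w₁, u, σ)` are Radon and σ-finite
  haveI hR : ∀ (σ : {w : InfinitePlace L // IsComplex w} → Equiv.Perm (Fin 3)) (w : {w : InfinitePlace L // IsComplex w}), IsFiniteMeasureOnCompacts ((fun w : {w : InfinitePlace L // IsComplex w} =>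
          if w ∈ S.erase w₁ then (νw w).map (fun g : archLocal L 3 (Matrix.diagonal α) w =>
            g * ⟨circleDiagonal 3 (u w ∘ ⇑(σ w)), circleDiagonal_mem_archLocal_diagonal L 3 α w _⟩ * g⁻¹)
          else Measure.dirac (⟨circleDiagonal 3 (fun _ => z w), circleDiagonal_mem_archLocal_diagonal L 3 α w _⟩ : archLocal L 3 (Matrix.diagonal α) w)) w) :=
    fun σ w => isFiniteMeasureOnCompacts_measureFamily₃ L α νw z hα _ u hu σ w
  haveI hσ : ∀ (σ : {w : InfinitePlace L // IsComplex w} → Equiv.Perm (Fin 3)) (w : {w : InfinitePlace L // IsComplex w}), SigmaFinite ((fun w : {w : InfinitePlace L // IsComplex w} =>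
          if w ∈ S.erase w₁ then (νw w).map (fun g : archLocal L 3 (Matrix.diagonal α) w =>
            g * ⟨circleDiagonal 3 (u w ∘ ⇑(σ w)), circleDiagonal_mem_archLocal_diagonal L 3 α w _⟩ * g⁻¹)
          else Measure.dirac (⟨circleDiagonal 3 (fun _ => z w), circleDiagonal_mem_archLocal_diagonal L 3 α w _⟩ : archLocal L 3 (Matrix.diagonal α) w)) w) :=
    fun σ w => sigmaFinite_measureFamily₃ L α νw z hα _ u hu σ w
  -- the off-`w₁` families, indexed by the off-`w₁` labels (pointwise equations: a function-level `Eq` into `Measure _` stalls the unifier)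
  obtain ⟨μ, hμ⟩ : ∃ μ : ({w : {w : InfinitePlace L // IsComplex w} // ¬ w = w₁} → Equiv.Perm (Fin 3)) → ∀ w' : {w : {w : InfinitePlace L // IsComplex w} // ¬ w = w₁}, Measure (archLocal L 3 (Matrix.diagonal α) w'.1),
      ∀ σ'' w', μ σ'' w' = (fun (w : {w : InfinitePlace L // IsComplex w}) (τ : Equiv.Perm (Fin 3)) =>
          if w ∈ S.erase w₁ then (νw w).map (fun g : archLocal L 3 (Matrix.diagonal α) w =>
            g * ⟨circleDiagonal 3 (u w ∘ ⇑τ), circleDiagonal_mem_archLocal_diagonal L 3 α w _⟩ * g⁻¹)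
          else Measure.dirac (⟨circleDiagonal 3 (fun _ => z w), circleDiagonal_mem_archLocal_diagonal L 3 α w _⟩ : archLocal L 3 (Matrix.diagonal α) w)) w'.1 (σ'' w') :=
    ⟨_, fun _ _ => rfl⟩
  haveI hμR : ∀ σ'' w', IsFiniteMeasureOnCompacts (μ σ'' w') := by
    intro σ'' w'
    rw [hμ]
    simp only []
    split_ifs with hw
    · exact isFiniteMeasureOnCompacts_map_conj_circleDiagonal L 3 α w'.1 hα _ (injective_comp_perm (hu w'.1 hw) (σ'' w')) (νw w'.1)
    · infer_instance
  haveI hμσ : ∀ σ'' w', SigmaFinite (μ σ'' w') := by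
    intro σ'' w'
    rw [hμ]
    simp only []
    split_ifs with hw
    · exact sigmaFinite_map_conj_circleDiagonal L 3 α w'.1 hα _ (injective_comp_perm (hu w'.1 hw) (σ'' w')) (νw w'.1)
    · infer_instance
  -- the family of `S ∖ w₁` restricted off `w₁` IS `μ (σ|)`
  have hfam : ∀ σ : {w : InfinitePlace L // IsComplex w} → Equiv.Perm (Fin 3), (fun w' : {w : {w : InfinitePlace L // IsComplex w} // ¬ w = w₁} => (fun w : {w : InfinitePlace L // IsComplex w} =>
          if w ∈ S.erase w₁ then (νw w).map (fun g : archLocal L 3 (Matrix.diagonal α) w =>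
            g * ⟨circleDiagonal 3 (u w ∘ ⇑(σ w)), circleDiagonal_mem_archLocal_diagonal L 3 α w _⟩ * g⁻¹)
          else Measure.dirac (⟨circleDiagonal 3 (fun _ => z w), circleDiagonal_mem_archLocal_diagonal L 3 α w _⟩ : archLocal L 3 (Matrix.diagonal α) w)) w'.1) = μ (fun w' => σ w'.1) := by
    intro σ; funext w'; rw [hμ]
  -- §2 at `w₁`
  have hE := tendsto_lambda8_sum_perm_integral_integral_insert L α hα w₁ hreal (νw w₁) μ Θ hΘ hΘc (z w₁) c hL
  -- (i) the frozen value is `I(S ∖ w₁, u)`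
  have h1 : ∀ σ : {w : InfinitePlace L // IsComplex w} → Equiv.Perm (Fin 3), (∫ o, Θ (((((archPiEquivCM 3 L (Matrix.diagonal α)).symm o) : arch (↥(maximalRealSubfield L)) L (IsCMField.complexConj L) 3 (Matrix.diagonal α)) : GL (Fin 3) (mixedSpace L)) : Matrix (Fin 3) (Fin 3) (mixedSpace L))
          ∂(Measure.pi (fun w : {w : InfinitePlace L // IsComplex w} =>
          if w ∈ S.erase w₁ then (νw w).map (fun g : archLocal L 3 (Matrix.diagonal α) w =>
            g * ⟨circleDiagonal 3 (u w ∘ ⇑(σ w)), circleDiagonal_mem_archLocal_diagonal L 3 α w _⟩ * g⁻¹)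
          else Measure.dirac (⟨circleDiagonal 3 (fun _ => z w), circleDiagonal_mem_archLocal_diagonal L 3 α w _⟩ : archLocal L 3 (Matrix.diagonal α) w)))) =
        ∫ o : (∀ w' : {w : {w : InfinitePlace L // IsComplex w} // ¬ w = w₁}, archLocal L 3 (Matrix.diagonal α) w'.1),
            Θ ((((archPiEquivCM 3 L (Matrix.diagonal α)).symm
            ((MeasurableEquiv.piEquivPiSubtypeProd (fun w : {w : InfinitePlace L // IsComplex w} => ↥(archLocal L 3 (Matrix.diagonal α) w)) (· = w₁)).symm
              ((MeasurableEquiv.piUnique fun i : {w : {w : InfinitePlace L // IsComplex w} // w = w₁} => ↥(archLocal L 3 (Matrix.diagonal α) i.1)).symm ((⟨circleDiagonal 3 (fun _ : Fin 3 => z w₁), circleDiagonal_mem_archLocal_diagonal L 3 α w₁ _⟩ : archLocal L 3 (Matrix.diagonal α) w₁)), o)) :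
              arch (↥(maximalRealSubfield L)) L (IsCMField.complexConj L) 3 (Matrix.diagonal α)) : GL (Fin 3) (mixedSpace L)) : Matrix (Fin 3) (Fin 3) (mixedSpace L)) ∂(Measure.pi (μ (fun w' => σ w'.1))) := by
    intro σ
    rw [← hfam σ]
    conv_lhs => rw [measureFamily₃_eq_update_dirac L α νw z (S.erase w₁) w₁ (Finset.notMem_erase w₁ S) u σ]
    exact integral_pi_update_dirac_archLocal L 3 α (fun w : {w : InfinitePlace L // IsComplex w} =>
          if w ∈ S.erase w₁ then (νw w).map (fun g : archLocal L 3 (Matrix.diagonal α) w =>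
            g * ⟨circleDiagonal 3 (u w ∘ ⇑(σ w)), circleDiagonal_mem_archLocal_diagonal L 3 α w _⟩ * g⁻¹)
          else Measure.dirac (⟨circleDiagonal 3 (fun _ => z w), circleDiagonal_mem_archLocal_diagonal L 3 α w _⟩ : archLocal L 3 (Matrix.diagonal α) w)) w₁ (⟨circleDiagonal 3 (fun _ : Fin 3 => z w₁), circleDiagonal_mem_archLocal_diagonal L 3 α w₁ _⟩ : archLocal L 3 (Matrix.diagonal α) w₁) (fun o : (∀ w : {w : InfinitePlace L // IsComplex w}, archLocal L 3 (Matrix.diagonal α) w) => Θ (((((archPiEquivCM 3 L (Matrix.diagonal α)).symm o) : arch (↥(maximalRealSubfield L)) L (IsCMField.complexConj L) 3 (Matrix.diagonal α)) : GL (Fin 3) (mixedSpace L)) : Matrix (Fin 3) (Fin 3) (mixedSpace L)))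
      (integrable_pi_update_of_hasCompactSupport (fun w : {w : InfinitePlace L // IsComplex w} =>
          if w ∈ S.erase w₁ then (νw w).map (fun g : archLocal L 3 (Matrix.diagonal α) w =>
            g * ⟨circleDiagonal 3 (u w ∘ ⇑(σ w)), circleDiagonal_mem_archLocal_diagonal L 3 α w _⟩ * g⁻¹)
          else Measure.dirac (⟨circleDiagonal 3 (fun _ => z w), circleDiagonal_mem_archLocal_diagonal L 3 α w _⟩ : archLocal L 3 (Matrix.diagonal α) w)) w₁ (Measure.dirac (⟨circleDiagonal 3 (fun _ : Fin 3 => z w₁), circleDiagonal_mem_archLocal_diagonal L 3 α w₁ _⟩ : archLocal L 3 (Matrix.diagonal α) w₁)) (fun o : (∀ w : {w : InfinitePlace L // IsComplex w}, archLocal L 3 (Matrix.diagonal α) w) => Θ (((((archPiEquivCM 3 L (Matrix.diagonal α)).symm o) : arch (↥(maximalRealSubfield L)) L (IsCMField.complexConj L) 3 (Matrix.diagonal α)) : GL (Fin 3) (mixedSpace L)) : Matrix (Fin 3) (Fin 3) (mixedSpace L))) hFc hFs)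
  have hval : (∑ _τ : Equiv.Perm (Fin 3), ∑ j : {w : {w : InfinitePlace L // IsComplex w} // ¬ w = w₁} → Equiv.Perm (Fin 3), ∫ o : (∀ w' : {w : {w : InfinitePlace L // IsComplex w} // ¬ w = w₁}, archLocal L 3 (Matrix.diagonal α) w'.1),
            Θ ((((archPiEquivCM 3 L (Matrix.diagonal α)).symm
            ((MeasurableEquiv.piEquivPiSubtypeProd (fun w : {w : InfinitePlace L // IsComplex w} => ↥(archLocal L 3 (Matrix.diagonal α) w)) (· = w₁)).symm
              ((MeasurableEquiv.piUnique fun i : {w : {w : InfinitePlace L // IsComplex w} // w = w₁} => ↥(archLocal L 3 (Matrix.diagonal α) i.1)).symm ((⟨circleDiagonal 3 (fun _ : Fin 3 => z w₁), circleDiagonal_mem_archLocal_diagonal L 3 α w₁ _⟩ : archLocal L 3 (Matrix.diagonal α) w₁)), o)) :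
              arch (↥(maximalRealSubfield L)) L (IsCMField.complexConj L) 3 (Matrix.diagonal α)) : GL (Fin 3) (mixedSpace L)) : Matrix (Fin 3) (Fin 3) (mixedSpace L)) ∂(Measure.pi (μ j))) =
      ∑ σ : {w : InfinitePlace L // IsComplex w} → Equiv.Perm (Fin 3),
        ∫ o, Θ (((((archPiEquivCM 3 L (Matrix.diagonal α)).symm o) : arch (↥(maximalRealSubfield L)) L (IsCMField.complexConj L) 3 (Matrix.diagonal α)) : GL (Fin 3) (mixedSpace L)) : Matrix (Fin 3) (Fin 3) (mixedSpace L))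
          ∂(Measure.pi (fun w : {w : InfinitePlace L // IsComplex w} =>
          if w ∈ S.erase w₁ then (νw w).map (fun g : archLocal L 3 (Matrix.diagonal α) w =>
            g * ⟨circleDiagonal 3 (u w ∘ ⇑(σ w)), circleDiagonal_mem_archLocal_diagonal L 3 α w _⟩ * g⁻¹)
          else Measure.dirac (⟨circleDiagonal 3 (fun _ => z w), circleDiagonal_mem_archLocal_diagonal L 3 α w _⟩ : archLocal L 3 (Matrix.diagonal α) w))) := by
    simp only [h1]
    rw [← Fintype.sum_prod_type', ← (Equiv.piSplitAt w₁ (fun _ : {w : InfinitePlace L // IsComplex w} => Equiv.Perm (Fin 3))).sum_comp]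
    simp only [Equiv.piSplitAt_apply]
  rw [hval] at hE
  -- (ii) on the regular set the two functionals agree
  have h2 : ∀ (r : Fin 3 → Circle), Function.Injective r → ∀ σ : {w : InfinitePlace L // IsComplex w} → Equiv.Perm (Fin 3), (∫ o, Θ (((((archPiEquivCM 3 L (Matrix.diagonal α)).symm o) : arch (↥(maximalRealSubfield L)) L (IsCMField.complexConj L) 3 (Matrix.diagonal α)) : GL (Fin 3) (mixedSpace L)) : Matrix (Fin 3) (Fin 3) (mixedSpace L))
          ∂(Measure.pi (fun w : {w : InfinitePlace L // IsComplex w} =>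
          if w ∈ S then (νw w).map (fun g : archLocal L 3 (Matrix.diagonal α) w =>
            g * ⟨circleDiagonal 3 ((Function.update u w₁ r) w ∘ ⇑(σ w)), circleDiagonal_mem_archLocal_diagonal L 3 α w _⟩ * g⁻¹)
          else Measure.dirac (⟨circleDiagonal 3 (fun _ => z w), circleDiagonal_mem_archLocal_diagonal L 3 α w _⟩ : archLocal L 3 (Matrix.diagonal α) w)))) =
        ∫ k : archLocal L 3 (Matrix.diagonal α) w₁, ∫ o : (∀ w' : {w : {w : InfinitePlace L // IsComplex w} // ¬ w = w₁}, archLocal L 3 (Matrix.diagonal α) w'.1),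
            Θ ((((archPiEquivCM 3 L (Matrix.diagonal α)).symm
            ((MeasurableEquiv.piEquivPiSubtypeProd (fun w : {w : InfinitePlace L // IsComplex w} => ↥(archLocal L 3 (Matrix.diagonal α) w)) (· = w₁)).symm
              ((MeasurableEquiv.piUnique fun i : {w : {w : InfinitePlace L // IsComplex w} // w = w₁} => ↥(archLocal L 3 (Matrix.diagonal α) i.1)).symm (k * ⟨circleDiagonal 3 (r ∘ ⇑(σ w₁)), circleDiagonal_mem_archLocal_diagonal L 3 α w₁ _⟩ * k⁻¹), o)) :
              arch (↥(maximalRealSubfield L)) L (IsCMField.complexConj L) 3 (Matrix.diagonal α)) : GL (Fin 3) (mixedSpace L)) : Matrix (Fin 3) (Fin 3) (mixedSpace L)) ∂(Measure.pi (μ (fun w' => σ w'.1))) ∂(νw w₁) := by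
    intro r hr σ
    haveI := isFiniteMeasureOnCompacts_map_conj_circleDiagonal L 3 α w₁ hα _ (injective_comp_perm hr (σ w₁)) (νw w₁)
    haveI := sigmaFinite_map_conj_circleDiagonal L 3 α w₁ hα _ (injective_comp_perm hr (σ w₁)) (νw w₁)
    rw [← hfam σ, measureFamily₃_update_eq_update L α νw z S w₁ hw₁ u r σ]
    exact integral_pi_update_map_conj_circleDiagonal_archLocal L 3 α (fun w : {w : InfinitePlace L // IsComplex w} =>
          if w ∈ S.erase w₁ then (νw w).map (fun g : archLocal L 3 (Matrix.diagonal α) w =>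
            g * ⟨circleDiagonal 3 (u w ∘ ⇑(σ w)), circleDiagonal_mem_archLocal_diagonal L 3 α w _⟩ * g⁻¹)
          else Measure.dirac (⟨circleDiagonal 3 (fun _ => z w), circleDiagonal_mem_archLocal_diagonal L 3 α w _⟩ : archLocal L 3 (Matrix.diagonal α) w)) w₁ (r ∘ ⇑(σ w₁)) (νw w₁) (fun o : (∀ w : {w : InfinitePlace L // IsComplex w}, archLocal L 3 (Matrix.diagonal α) w) => Θ (((((archPiEquivCM 3 L (Matrix.diagonal α)).symm o) : arch (↥(maximalRealSubfield L)) L (IsCMField.complexConj L) 3 (Matrix.diagonal α)) : GL (Fin 3) (mixedSpace L)) : Matrix (Fin 3) (Fin 3) (mixedSpace L))) hFm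
      (integrable_pi_update_of_hasCompactSupport (fun w : {w : InfinitePlace L // IsComplex w} =>
          if w ∈ S.erase w₁ then (νw w).map (fun g : archLocal L 3 (Matrix.diagonal α) w =>
            g * ⟨circleDiagonal 3 (u w ∘ ⇑(σ w)), circleDiagonal_mem_archLocal_diagonal L 3 α w _⟩ * g⁻¹)
          else Measure.dirac (⟨circleDiagonal 3 (fun _ => z w), circleDiagonal_mem_archLocal_diagonal L 3 α w _⟩ : archLocal L 3 (Matrix.diagonal α) w)) w₁ _ (fun o : (∀ w : {w : InfinitePlace L // IsComplex w}, archLocal L 3 (Matrix.diagonal α) w) => Θ (((((archPiEquivCM 3 L (Matrix.diagonal α)).symm o) : arch (↥(maximalRealSubfield L)) L (IsCMField.complexConj L) 3 (Matrix.diagonal α)) : GL (Fin 3) (mixedSpace L)) : Matrix (Fin 3) (Fin 3) (mixedSpace L))) hFc hFs)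
  have hfun : Set.EqOn (fun r : Fin 3 → Circle => ∑ τ : Equiv.Perm (Fin 3), ∑ j : {w : {w : InfinitePlace L // IsComplex w} // ¬ w = w₁} → Equiv.Perm (Fin 3), ∫ k : archLocal L 3 (Matrix.diagonal α) w₁, ∫ o : (∀ w' : {w : {w : InfinitePlace L // IsComplex w} // ¬ w = w₁}, archLocal L 3 (Matrix.diagonal α) w'.1),
            Θ ((((archPiEquivCM 3 L (Matrix.diagonal α)).symm
            ((MeasurableEquiv.piEquivPiSubtypeProd (fun w : {w : InfinitePlace L // IsComplex w} => ↥(archLocal L 3 (Matrix.diagonal α) w)) (· = w₁)).symm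
              ((MeasurableEquiv.piUnique fun i : {w : {w : InfinitePlace L // IsComplex w} // w = w₁} => ↥(archLocal L 3 (Matrix.diagonal α) i.1)).symm (k * ⟨circleDiagonal 3 (r ∘ ⇑τ), circleDiagonal_mem_archLocal_diagonal L 3 α w₁ _⟩ * k⁻¹), o)) :
              arch (↥(maximalRealSubfield L)) L (IsCMField.complexConj L) 3 (Matrix.diagonal α)) : GL (Fin 3) (mixedSpace L)) : Matrix (Fin 3) (Fin 3) (mixedSpace L)) ∂(Measure.pi (μ j)) ∂(νw w₁))
      (fun r : Fin 3 → Circle => ∑ σ : {w : InfinitePlace L // IsComplex w} → Equiv.Perm (Fin 3),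
        ∫ o, Θ (((((archPiEquivCM 3 L (Matrix.diagonal α)).symm o) : arch (↥(maximalRealSubfield L)) L (IsCMField.complexConj L) 3 (Matrix.diagonal α)) : GL (Fin 3) (mixedSpace L)) : Matrix (Fin 3) (Fin 3) (mixedSpace L))
          ∂(Measure.pi (fun w : {w : InfinitePlace L // IsComplex w} =>
          if w ∈ S then (νw w).map (fun g : archLocal L 3 (Matrix.diagonal α) w =>
            g * ⟨circleDiagonal 3 ((Function.update u w₁ r) w ∘ ⇑(σ w)), circleDiagonal_mem_archLocal_diagonal L 3 α w _⟩ * g⁻¹)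
          else Measure.dirac (⟨circleDiagonal 3 (fun _ => z w), circleDiagonal_mem_archLocal_diagonal L 3 α w _⟩ : archLocal L 3 (Matrix.diagonal α) w)))) {r : Fin 3 → Circle | Function.Injective r} := by
    intro r hr
    simp only [h2 r hr]
    rw [← Fintype.sum_prod_type', ← (Equiv.piSplitAt w₁ (fun _ : {w : InfinitePlace L // IsComplex w} => Equiv.Perm (Fin 3))).sum_comp]
    simp only [Equiv.piSplitAt_apply]
  refine hE.congr' ?_
  filter_upwards [self_mem_nhdsWithin] with x hx
  exact lambda8_rhoWeylDelta_mul_congr _ _ hfun x hx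

end Step

end Literature.NumberTheory.Automorphic.UnitaryGroup

end
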